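import Literature.Geometry.Riemannian.HamiltonPCOPinchingTwo
import Literature.Geometry.Riemannian.HamiltonPCOPinchingThreeCore
import Literature.Geometry.Riemannian.HamiltonConcavityLemma
import Mathlib.Analysis.SpecialFunctions.Pow.Deriv
import Mathlib.Analysis.SpecialFunctions.Pow.Continuity
import HarnessLib

/-!
# Hamilton 1986, Thm. 7.1, inequality (3): `(b₂ + b₃)^{2+δ} ≤ J a₁c₁(a - 2b + c)^δ` is preserved — proved
(topic `Geometry/Riemannian`)

Third brick of the pinching set of **Hamilton 1986, Thm. 7.1** (J. Differential Geom. 24,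
p. 170; the ODE layer of `Literature.Geometry.Riemannian.hamilton_positiveCurvatureOperator_classification_four`,
see `HamiltonPCOPinchingOne.lean`, `HamiltonPCOPinchingTwo.lean`). Hamilton, p. 172: "For the
third inequality we need to use the terms we threw away in the first", Lemma 7.3, and (7.4):
`d/dt log [a₁c₁/(b₂ + b₃)²] ≥ δ(a₃ - a₁) + δ(c₃ - c₁)`; "Since we also have
`d/dt log [(b₂ + b₃)/(a - 2b + c)] ≤ (a₃ - a₁) + (c₃ - c₁)` [Lemma 7.2 with Lemma 6.2] we
conclude that the inequality `(b₂ + b₃)^{2+δ} ≤ J a₁c₁(a - 2b + c)^δ` will be preserved for any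
constant `J`." Here `a = tr A`, `c = tr C`, `b = b₁ + b₂ + b₃ = sup {tr (BT) : T ∈ O(3)}`.

PROVED here at the ODE level (`HamiltonODE.IsInvariantRel`), in closed variational form:

* `SingularValuesSumPowLE p J δ` — for all orthonormal pairs `(u₁, u₂)`, `(v₁, v₂)`, unit `w`, `z`
  and orthogonal `T`: `((u₁ᵀBv₁ + u₂ᵀBv₂)²)^{1+δ/2} ≤ J (wᵀAw)(zᵀCz)(tr A - 2 tr (BT) + tr C)^δ`
  (on `{M ≥ 0}`, where `a₁, c₁ ≥ 0` and `tr A - 2 tr (BT) + tr C ≥ 0` for every `T`, this is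
  exactly `(b₂ + b₃)^{2+δ} ≤ J a₁ c₁ (a - 2b + c)^δ`, the extrema being attained);
* `hamilton1986_pinchingThree_ode` — for `0 < m, G, J`, `0 < δ ≤ 1` with `8Hδ ≤ 1` and
  `4GHδ² ≤ 1`, this set is forward invariant under Hamilton's ODE relative to
  `Z₂(m, G, H) = {A, C symmetric} ∩ {tr A = tr C} ∩ {M ≥ m} ∩ {(1)} ∩ {(2)}` (`pcoPinchingTwo`),
  itself invariant (`isInvariant_pcoPinchingTwo`); whence the invariant set
  `pcoPinchingThree = Z₂ ∩ {(3)}` (`isInvariant_pcoPinchingThree`), closed and `B ↦ -B`-symmetric.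
  Smallness of `δ`: the printed Lemma 7.3 asks `δ ≤ min(1/4H, 1/√(12GH))` using `c₁ ≤ c ≤ 3a₃`;
  the variational bookkeeping (`lemma73`, `HamiltonPCOPinchingThreeCore.lean`, with `c₁ ≤ c/3`)
  works under `8Hδ ≤ 1`, `4GHδ² ≤ 1`; Thm. 7.1 only needs *some* `δ > 0` depending on `G, H`.

Proof: barrier lemma `minOverSet_nonneg_of_deriv` for `𝒢 = J X X_C W(T)^δ - (Y²)^{1+δ/2}` over
`pairSet² × unitSet² × O(3)` (`X = wᵀAw`, `X_C = zᵀCz`, `W(T) = tr A - 2 tr (BT) + tr C ≥ 6m`,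
`Y` the Ky Fan sum). At a minimiser with `𝒢 ≤ 0`: `T` maximises `tr (BT)`, `w`, `z` minimise,
the frames maximise `|Y|` and are rotated to a diagonal maximiser; with `Φ = J X X_C W^δ`,
`Ψ = (Y²)^{1+δ/2} ≥ Φ`, the logarithmic derivatives satisfy `Ψ'/Ψ ≤ ℓ ≤ Φ'/Φ` for the explicit
`ℓ` of Lemma 7.2 (pointwise inputs of `HamiltonPCOPinchingThreeCore.lean` and Lemma 7.3), hence
`𝒢' ≥ ℓ 𝒢 ≥ C 𝒢` with `C = 3R/m`, `R` bounding the entries of the field along the solution.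

## References

* R. S. Hamilton, *Four-manifolds with positive curvature operator*, J. Differential Geom. 24
  (1986) 153–179: §6, Lemmas 6.1–6.2 (pp. 167–170); §7, Thm. 7.1 (p. 170), Lemma 7.2 (p. 171),
  Lemma 7.3 and (7.4) (p. 172). [Hamilton1986]
-/

noncomputable section

open Set Real Filter
open scoped Matrix BigOperators Topology

namespace Literature.Geometry.Riemannian

namespace HamiltonODE

/-! ### The set (3) and the barrier functional -/

/-- **`(b₂ + b₃)^{2+δ} ≤ J a₁ c₁ (a - 2b + c)^δ`** (Hamilton 1986, Thm. 7.1, inequality (3)),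
variationally and in closed form: for all orthonormal pairs `(u₁, u₂)`, `(v₁, v₂)`, unit `w`, `z`
and orthogonal `T`, `((u₁ᵀBv₁ + u₂ᵀBv₂)²)^{1+δ/2} ≤ J (wᵀAw)(zᵀCz)(tr A - 2 tr (BT) + tr C)^δ`
(`b = b₁ + b₂ + b₃ = sup tr (BT)` over `T ∈ O(3)`, p. 168; `b₂ + b₃`, `a₁`, `c₁` as in (1), p. 167).
[cite: Hamilton1986, §7, Thm. 7.1 (3) (p. 170); §6, pp. 167–168] -/
def SingularValuesSumPowLE (p : Blocks) (J δ : ℝ) : Prop :=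
  ∀ (u₁ u₂ v₁ v₂ w z : Fin 3 → ℝ) (T : Matrix (Fin 3) (Fin 3) ℝ),
    u₁ ⬝ᵥ u₁ = 1 → u₂ ⬝ᵥ u₂ = 1 → u₁ ⬝ᵥ u₂ = 0 → v₁ ⬝ᵥ v₁ = 1 → v₂ ⬝ᵥ v₂ = 1 → v₁ ⬝ᵥ v₂ = 0 →
    w ⬝ᵥ w = 1 → z ⬝ᵥ z = 1 → Tᵀ * T = 1 →
      ((u₁ ⬝ᵥ (p.2.1 *ᵥ v₁) + u₂ ⬝ᵥ (p.2.1 *ᵥ v₂)) ^ 2) ^ (1 + δ / 2) ≤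
        J * (w ⬝ᵥ (p.1 *ᵥ w)) * (z ⬝ᵥ (p.2.2 *ᵥ z)) *
          (p.1.trace - 2 * (p.2.1 * T).trace + p.2.2.trace) ^ δ

/-- `W(T) = tr A - 2 tr (BT) + tr C` (`= a - 2b + c` at a maximiser `T` of the trace). [folklore] -/
def traceW (p : Blocks) (T : Matrix (Fin 3) (Fin 3) ℝ) : ℝ :=
  p.1.trace - 2 * (p.2.1 * T).trace + p.2.2.trace

/-- The parameter type `(pairSet² × unitSet²) × ℝ^{3×3}` (the last factor as a function space, which
carries the sup metric needed by the barrier lemma; it is read as a matrix through `Matrix.of`).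
[folklore] -/
abbrev RR : Type := (PP × UU) × (Fin 3 → Fin 3 → ℝ)

/-- `T ↦ Matrix.of T` is continuous. [folklore] -/
theorem continuous_matrixOf : Continuous fun T : Fin 3 → Fin 3 → ℝ ↦ Matrix.of T :=
  continuous_matrix fun i j ↦ by
    show Continuous fun T : Fin 3 → Fin 3 → ℝ ↦ T i j
    exact (continuous_apply j).comp (continuous_apply i)

/-- The orthogonal group inside the function space is compact. [folklore] -/
theorem isCompact_orthogonalFunSet :
    IsCompact {T : Fin 3 → Fin 3 → ℝ | (Matrix.of T)ᵀ * Matrix.of T = 1} := by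
  have hbox : IsCompact (Set.univ.pi fun _ : Fin 3 ↦ Set.univ.pi fun _ : Fin 3 ↦ Set.Icc (-1 : ℝ) 1) :=
    isCompact_univ_pi fun _ ↦ isCompact_univ_pi fun _ ↦ isCompact_Icc
  have hclosed : IsClosed {T : Fin 3 → Fin 3 → ℝ | (Matrix.of T)ᵀ * Matrix.of T = 1} :=
    isClosed_eq (continuous_matrixOf.matrix_transpose.matrix_mul continuous_matrixOf) continuous_const
  refine hbox.of_isClosed_subset hclosed fun T hT ↦ ?_
  simp only [Set.mem_univ_pi]
  exact fun i j ↦ entry_mem_Icc_of_orthogonal hT i j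

/-- The parameter set `pairSet² × unitSet² × O(3)`. [folklore] -/
def pcoThreeSet : Set RR := pcoOneSet ×ˢ {T | (Matrix.of T)ᵀ * Matrix.of T = 1}

/-- It is compact. [folklore] -/
theorem isCompact_pcoThreeSet : IsCompact pcoThreeSet := isCompact_pcoOneSet.prod isCompact_orthogonalFunSet

/-- It is nonempty. [folklore] -/
theorem pcoThreeSet_nonempty : pcoThreeSet.Nonempty :=
  pcoOneSet_nonempty.prod ⟨Matrix.of.symm 1, by simp⟩

/-- The barrier functional `𝒢 = J X X_C W^δ - (Y²)^{1+δ/2}`. [folklore] -/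
def pcoThreeG (J δ : ℝ) (p : Blocks) (r : RR) : ℝ :=
  J * (r.1.2.1 ⬝ᵥ (p.1 *ᵥ r.1.2.1)) * (r.1.2.2 ⬝ᵥ (p.2.2 *ᵥ r.1.2.2)) * traceW p (Matrix.of r.2) ^ δ -
    (kyFanQ p.2.1 r.1.1 ^ 2) ^ (1 + δ / 2)

/-- Its derivative along a curve with velocity `p'` (where `W ≠ 0`). [folklore] -/
def pcoThreeG' (J δ : ℝ) (p p' : Blocks) (r : RR) : ℝ :=
  J * ((r.1.2.1 ⬝ᵥ (p'.1 *ᵥ r.1.2.1)) * (r.1.2.2 ⬝ᵥ (p.2.2 *ᵥ r.1.2.2)) * traceW p (Matrix.of r.2) ^ δ +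
      (r.1.2.1 ⬝ᵥ (p.1 *ᵥ r.1.2.1)) * (r.1.2.2 ⬝ᵥ (p'.2.2 *ᵥ r.1.2.2)) * traceW p (Matrix.of r.2) ^ δ +
      (r.1.2.1 ⬝ᵥ (p.1 *ᵥ r.1.2.1)) * (r.1.2.2 ⬝ᵥ (p.2.2 *ᵥ r.1.2.2)) *
        (traceW p' (Matrix.of r.2) * δ * traceW p (Matrix.of r.2) ^ (δ - 1))) -
    (2 * kyFanQ p.2.1 r.1.1 * kyFanQ p'.2.1 r.1.1) * (1 + δ / 2) * (kyFanQ p.2.1 r.1.1 ^ 2) ^ (δ / 2)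

/-- (3) iff `𝒢 ≥ 0` on the parameter set. [folklore] -/
theorem singularValuesSumPowLE_iff (J δ : ℝ) (p : Blocks) :
    SingularValuesSumPowLE p J δ ↔ ∀ r ∈ pcoThreeSet, 0 ≤ pcoThreeG J δ p r := by
  constructor
  · rintro h ⟨⟨⟨⟨u₁, u₂⟩, ⟨v₁, v₂⟩⟩, ⟨w, z⟩⟩, T⟩ ⟨⟨⟨⟨hu₁, hu₂, hu⟩, ⟨hv₁, hv₂, hv⟩⟩, ⟨hw, hz⟩⟩, hT⟩
    have := h u₁ u₂ v₁ v₂ w z (Matrix.of T) hu₁ hu₂ hu hv₁ hv₂ hv hw hz hT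
    simp only [pcoThreeG, kyFanQ, traceW]; linarith
  · intro h u₁ u₂ v₁ v₂ w z T hu₁ hu₂ hu hv₁ hv₂ hv hw hz hT
    have hT' : Matrix.of.symm T ∈ {T : Fin 3 → Fin 3 → ℝ | (Matrix.of T)ᵀ * Matrix.of T = 1} := by
      simpa using hT
    have := h ((((u₁, u₂), (v₁, v₂)), (w, z)), Matrix.of.symm T)
      ⟨⟨⟨⟨hu₁, hu₂, hu⟩, ⟨hv₁, hv₂, hv⟩⟩, ⟨hw, hz⟩⟩, hT'⟩
    simp only [pcoThreeG, kyFanQ, traceW, Equiv.apply_symm_apply] at this; linarith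

/-! ### `W(T) ≥ 6m` on `{M ≥ m}` and bounds for traces -/

/-- `ᵗeᵢ M eᵢ = Mᵢᵢ` summed over the standard basis gives the trace. [folklore] -/
theorem sum_single_quad_eq_trace (M : Matrix (Fin 3) (Fin 3) ℝ) :
    ∑ i : Fin 3, (Pi.single i 1 : Fin 3 → ℝ) ⬝ᵥ (M *ᵥ Pi.single i 1) = M.trace := by
  simp [Matrix.trace, Fin.sum_univ_three]

/-- **`a - 2 tr (BT) + c ≥ 6m` on `{M ≥ m}` for every orthogonal `T`** (Hamilton, p. 170: "if
`M > 0` then … `A - 2B + C > 0` (adding the matrices after identifying `Λ²₊` and `Λ²₋` by an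
isometry)"; sum `M((eᵢ, -Teᵢ), (eᵢ, -Teᵢ)) ≥ 2m` over a basis). [cite: Hamilton1986, §7, p. 170] -/
theorem traceW_ge_of_operatorGE {p : Blocks} {m : ℝ} (h : OperatorGE p m) {T : Matrix (Fin 3) (Fin 3) ℝ}
    (hT : Tᵀ * T = 1) : 6 * m ≤ traceW p T := by
  obtain ⟨A, B, C⟩ := p
  have hTT := mul_transpose_self_of_orthogonal hT
  have key : ∀ u : Fin 3 → ℝ, 2 * m * (u ⬝ᵥ u) ≤ u ⬝ᵥ ((A - (2 : ℝ) • (B * T) + Tᵀ * C * T) *ᵥ u) := by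
    intro u
    rw [quad_antidiag_conj]
    have h1 := h (u, -(T *ᵥ u))
    have hTu : (T *ᵥ u) ⬝ᵥ (T *ᵥ u) = u ⬝ᵥ u := by
      rw [← Matrix.dotProduct_transpose_mulVec, Matrix.mulVec_mulVec, hT, Matrix.one_mulVec]
    simp only [normSq, neg_dotProduct, dotProduct_neg, neg_neg, hTu] at h1
    linarith
  have hsum := Finset.sum_le_sum fun i (_ : i ∈ (Finset.univ : Finset (Fin 3))) ↦ key (Pi.single i 1)
  rw [sum_single_quad_eq_trace] at hsum
  have htr : (A - (2 : ℝ) • (B * T) + Tᵀ * C * T).trace = traceW (A, B, C) T := by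
    simp only [traceW, Matrix.trace_add, Matrix.trace_sub, Matrix.trace_smul, smul_eq_mul]
    rw [Matrix.trace_mul_cycle, hTT, Matrix.one_mul]
  rw [htr] at hsum
  have h1 : ∑ i : Fin 3, 2 * m * ((Pi.single i 1 : Fin 3 → ℝ) ⬝ᵥ Pi.single i 1) = 6 * m := by
    simp
    ring
  linarith

/-- `|tr (NT)| ≤ Σ|N|` for orthogonal `T` (entries of `T` in `[-1, 1]`). [folklore] -/
theorem abs_trace_mul_le_sum_of_orthogonal (N : Matrix (Fin 3) (Fin 3) ℝ) {T : Matrix (Fin 3) (Fin 3) ℝ}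
    (hT : Tᵀ * T = 1) : |(N * T).trace| ≤ ∑ k, ∑ l, |N k l| := by
  simp only [Matrix.trace, Matrix.diag, Matrix.mul_apply]
  refine (Finset.abs_sum_le_sum_abs _ _).trans (Finset.sum_le_sum fun k _ ↦
    (Finset.abs_sum_le_sum_abs _ _).trans (Finset.sum_le_sum fun l _ ↦ ?_))
  rw [abs_mul]
  have h := entry_mem_Icc_of_orthogonal hT l k
  have hl : |T l k| ≤ 1 := abs_le.2 ⟨h.1, h.2⟩
  have := abs_nonneg (N k l)
  calc |N k l| * |T l k| ≤ |N k l| * 1 := by gcongr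
    _ = |N k l| := mul_one _

/-! ### Calculus and continuity -/

/-- Derivative of `W(T)` along a differentiable curve of blocks. [folklore] -/
theorem hasDerivAt_traceW {γ : ℝ → Blocks} {γ' : Blocks} {s : ℝ} (hγ : HasDerivAt γ γ' s)
    (T : Matrix (Fin 3) (Fin 3) ℝ) :
    _root_.HasDerivAt (fun t ↦ traceW (γ t) T) (traceW γ' T) s := by
  have h1 := hγ.trace_fst
  have h3 := hγ.trace_snd_snd
  have h2 : _root_.HasDerivAt (fun t ↦ ((γ t).2.1 * T).trace) ((γ'.2.1 * T).trace) s := by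
    simp only [Matrix.trace, Matrix.diag, Matrix.mul_apply]
    exact HasDerivAt.fun_sum fun i _ ↦ HasDerivAt.fun_sum fun j _ ↦ (hγ.2.1 i j).mul_const _
  have h := (h1.sub (h2.const_mul 2)).add h3
  exact h

/-- Derivative of `𝒢` along a differentiable curve of blocks, where `W ≠ 0`. [folklore] -/
theorem hasDerivAt_pcoThreeG (J : ℝ) {δ : ℝ} (hδ : 0 < δ) {γ : ℝ → Blocks} {γ' : Blocks} {s : ℝ}
    (hγ : HasDerivAt γ γ' s) (r : RR) (hW : traceW (γ s) (Matrix.of r.2) ≠ 0) :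
    _root_.HasDerivAt (fun t ↦ pcoThreeG J δ (γ t) r) (pcoThreeG' J δ (γ s) γ' r) s := by
  have hX := hasDerivAt_quadForm hγ.1 r.1.2.1 r.1.2.1
  have hZ := hasDerivAt_quadForm hγ.2.2 r.1.2.2 r.1.2.2
  have hY := hasDerivAt_kyFanQ hγ.2.1 r.1.1
  have hWd := (hasDerivAt_traceW hγ (Matrix.of r.2)).rpow_const (p := δ) (Or.inl hW)
  have hS := (hY.pow 2).rpow_const (p := 1 + δ / 2) (Or.inr (by linarith))
  have h := (((hX.mul hZ).mul hWd).const_mul J).sub hS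
  refine (h.congr_of_eventuallyEq (Filter.Eventually.of_forall fun t ↦ ?_)).congr_deriv ?_
  · simp only [pcoThreeG, Pi.mul_apply, Pi.sub_apply, Pi.pow_apply]
    ring
  · have e1 : (1 + δ / 2 - 1) = δ / 2 := by ring
    rw [e1]
    simp only [pcoThreeG', Nat.cast_ofNat, Pi.mul_apply, Pi.pow_apply]
    ring

section Continuity

variable (J δ : ℝ)

/-- `(p, T) ↦ W` is continuous. [folklore] -/
theorem continuous_traceW : Continuous fun z : Blocks × Matrix (Fin 3) (Fin 3) ℝ ↦ traceW z.1 z.2 := by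
  unfold traceW
  exact ((continuous_fst.fst.matrix_trace).sub (continuous_const.mul
    ((continuous_fst.snd.fst.matrix_mul continuous_snd).matrix_trace))).add
    continuous_fst.snd.snd.matrix_trace

/-- `(p, r) ↦ 𝒢` is continuous for `δ ≥ 0`. [folklore] -/
theorem continuous_pcoThreeG (hδ : 0 ≤ δ) : Continuous fun z : Blocks × RR ↦ pcoThreeG J δ z.1 z.2 := by
  unfold pcoThreeG
  have hX := continuous_quadForm
  have hY := continuous_kyFanQ'
  have hp : Continuous fun z : Blocks × RR ↦ z.1 := continuous_fst
  have hr : Continuous fun z : Blocks × RR ↦ z.2 := continuous_snd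
  have hw := continuous_fst.comp (continuous_snd.comp (continuous_fst.comp hr))
  have hz := continuous_snd.comp (continuous_snd.comp (continuous_fst.comp hr))
  have hF := continuous_fst.comp (continuous_fst.comp hr)
  have hT := continuous_snd.comp hr
  have hW : Continuous fun z : Blocks × RR ↦ traceW z.1 (Matrix.of z.2.2) :=
    continuous_traceW.comp (hp.prodMk (continuous_matrixOf.comp hT))
  refine (((continuous_const.mul (hX.comp ((continuous_fst.comp hp).prodMk (hw.prodMk hw)))).mul
    (hX.comp ((continuous_snd.comp (continuous_snd.comp hp)).prodMk (hz.prodMk hz)))).mul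
    (hW.rpow_const fun _ ↦ Or.inr hδ)).sub ?_
  exact ((hY.comp ((continuous_fst.comp (continuous_snd.comp hp)).prodMk hF)).pow 2).rpow_const
    fun _ ↦ Or.inr (by linarith)

/-- `(p, p', r) ↦ 𝒢'` is continuous on `{W ≠ 0}` for `δ ≥ 0`. [folklore] -/
theorem continuousOn_pcoThreeG' (hδ : 0 ≤ δ) :
    ContinuousOn (fun z : Blocks × Blocks × RR ↦ pcoThreeG' J δ z.1 z.2.1 z.2.2)
      {z | traceW z.1 (Matrix.of z.2.2.2) ≠ 0} := by
  unfold pcoThreeG'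
  have hX := continuous_quadForm
  have hY := continuous_kyFanQ'
  have hp : Continuous fun z : Blocks × Blocks × RR ↦ z.1 := continuous_fst
  have hp' : Continuous fun z : Blocks × Blocks × RR ↦ z.2.1 := continuous_fst.comp continuous_snd
  have hr : Continuous fun z : Blocks × Blocks × RR ↦ z.2.2 := continuous_snd.comp continuous_snd
  have hw := continuous_fst.comp (continuous_snd.comp (continuous_fst.comp hr))
  have hz := continuous_snd.comp (continuous_snd.comp (continuous_fst.comp hr))
  have hF := continuous_fst.comp (continuous_fst.comp hr)
  have hT := continuous_snd.comp hr
  have hTM := continuous_matrixOf.comp hT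
  have hW : Continuous fun z : Blocks × Blocks × RR ↦ traceW z.1 (Matrix.of z.2.2.2) :=
    continuous_traceW.comp (hp.prodMk hTM)
  have hW' : Continuous fun z : Blocks × Blocks × RR ↦ traceW z.2.1 (Matrix.of z.2.2.2) :=
    continuous_traceW.comp (hp'.prodMk hTM)
  have hXp := hX.comp ((continuous_fst.comp hp).prodMk (hw.prodMk hw))
  have hXp' := hX.comp ((continuous_fst.comp hp').prodMk (hw.prodMk hw))
  have hZp := hX.comp ((continuous_snd.comp (continuous_snd.comp hp)).prodMk (hz.prodMk hz))
  have hZp' := hX.comp ((continuous_snd.comp (continuous_snd.comp hp')).prodMk (hz.prodMk hz))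
  have hYp := hY.comp ((continuous_fst.comp (continuous_snd.comp hp)).prodMk hF)
  have hYp' := hY.comp ((continuous_fst.comp (continuous_snd.comp hp')).prodMk hF)
  have hWδ : Continuous fun z : Blocks × Blocks × RR ↦ traceW z.1 (Matrix.of z.2.2.2) ^ δ :=
    hW.rpow_const fun _ ↦ Or.inr hδ
  have hWδ1 : ContinuousOn (fun z : Blocks × Blocks × RR ↦ traceW z.1 (Matrix.of z.2.2.2) ^ (δ - 1))
      {z | traceW z.1 (Matrix.of z.2.2.2) ≠ 0} := hW.continuousOn.rpow_const fun z hz ↦ Or.inl hz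
  have hSδ : Continuous fun z : Blocks × Blocks × RR ↦ (kyFanQ z.1.2.1 z.2.2.1.1 ^ 2) ^ (δ / 2) :=
    (hYp.pow 2).rpow_const fun _ ↦ Or.inr (by linarith)
  refine ((continuous_const.continuousOn.mul ((((hXp'.mul hZp).mul hWδ).add
    ((hXp.mul hZp').mul hWδ)).continuousOn.add ((hXp.mul hZp).continuousOn.mul
    (((hW'.mul continuous_const).continuousOn.mul hWδ1))))).sub ?_)
  exact (((continuous_const.mul hYp).mul hYp').mul continuous_const |>.mul hSδ).continuousOn

attribute [local irreducible] pcoThreeG in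
/-- Joint continuity of `𝒢` along a continuous curve. [folklore] -/
theorem continuousOn_pcoThreeG_family (hδ : 0 ≤ δ) {γ : ℝ → Blocks} {S : Set ℝ} (hγ : ContinuousOn γ S)
    (K : Set RR) : ContinuousOn (fun z : ℝ × RR ↦ pcoThreeG J δ (γ z.1) z.2) (S ×ˢ K) := by
  have h1 : ContinuousOn (fun z : ℝ × RR ↦ γ z.1) (S ×ˢ K) :=
    hγ.comp continuousOn_fst fun z hz ↦ (Set.mem_prod.1 hz).1
  exact (continuous_pcoThreeG J δ hδ).continuousOn.comp (h1.prodMk continuousOn_snd) (Set.mapsTo_univ _ _)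

attribute [local irreducible] pcoThreeG' in
/-- Joint continuity of `𝒢'` along a continuous solution, where `W ≠ 0`. [folklore] -/
theorem continuousOn_pcoThreeG'_family (hδ : 0 ≤ δ) {γ : ℝ → Blocks} {S : Set ℝ} (hγ : ContinuousOn γ S)
    (K : Set RR) (hW : ∀ z ∈ S ×ˢ K, traceW (γ z.1) (Matrix.of z.2.2) ≠ 0) :
    ContinuousOn (fun z : ℝ × RR ↦ pcoThreeG' J δ (γ z.1) (field (γ z.1)) z.2) (S ×ˢ K) := by
  have h1 : ContinuousOn (fun z : ℝ × RR ↦ γ z.1) (S ×ˢ K) :=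
    hγ.comp continuousOn_fst fun z hz ↦ (Set.mem_prod.1 hz).1
  refine (continuousOn_pcoThreeG' J δ hδ).comp
    (h1.prodMk ((continuous_field.comp_continuousOn h1).prodMk continuousOn_snd)) fun z hz ↦ ?_
  exact hW z hz

end Continuity

/-! ### The scalar bookkeeping (Hamilton 1986, p. 172, (7.4) and the conclusion) -/

/-- **Comparison of the logarithmic derivatives** (Hamilton, p. 172): with the lower bound
`ℓ_Φ = (x² + k² + 2Mᴬa₂)/x + (x_c² + k² + 2Mᶜc₂)/x_c + δ(x + 2k + x_c)` for
`d/dt log (a₁c₁(a - 2b + c)^δ)` and the upper bound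
`ℓ_Ψ = (2 + δ)(Mᴬ + Mᶜ + 2k) - (2 + δ)(μ/Y)[(Mᴬ - a₂) + (Mᶜ - c₂)]` for `d/dt log (b₂ + b₃)^{2+δ}`,
Lemma 7.3 (both blocks) gives `ℓ_Ψ ≤ ℓ_Φ`. [cite: Hamilton1986, §7, (7.4) and p. 172] -/
theorem pcoThree_logCompare {x a MA xc c MC k μ Y δ : ℝ} (hx : 0 < x) (hxc : 0 < xc)
    (hδ : 0 < δ) (hxM : x ≤ MA) (hxcM : xc ≤ MC) (haM : a ≤ MA) (hcM : c ≤ MC) (hμY : 0 ≤ μ / Y)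
    (h73A : 2 * δ * (MA - x) ≤ (x - k) ^ 2 / x + 2 * MA * (a - x) / x + 2 * (μ / Y) * (MA - a))
    (h73C : 2 * δ * (MC - xc) ≤ (xc - k) ^ 2 / xc + 2 * MC * (c - xc) / xc + 2 * (μ / Y) * (MC - c)) :
    (2 + δ) * (MA + MC + 2 * k) - (2 + δ) * (μ / Y) * ((MA - a) + (MC - c)) ≤
      (x ^ 2 + k ^ 2 + 2 * MA * a) / x + (xc ^ 2 + k ^ 2 + 2 * MC * c) / xc + δ * (x + 2 * k + xc) := by
  have eA : (x ^ 2 + k ^ 2 + 2 * MA * a) / x = 2 * k + 2 * MA + ((x - k) ^ 2 / x + 2 * MA * (a - x) / x) := by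
    field_simp
    ring
  have eC : (xc ^ 2 + k ^ 2 + 2 * MC * c) / xc =
      2 * k + 2 * MC + ((xc - k) ^ 2 / xc + 2 * MC * (c - xc) / xc) := by
    field_simp
    ring
  rw [eA, eC]
  have h1 : 0 ≤ δ * (μ / Y) * ((MA - a) + (MC - c)) := by
    have : 0 ≤ (MA - a) + (MC - c) := by linarith
    positivity
  nlinarith

/-- **The two logarithmic-derivative bounds, scalar form** (Hamilton 1986, p. 172): from the
pointwise data of Lemmas 6.1, 6.2 (`X' ≥ x² + k² + 2Mᴬa₂`, `X_C' ≥ …`, `W' ≥ (x + 2k + x_c)W`,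
`Y' ≤ (Mᴬ + Mᶜ + 2k)Y - μ[(a₃ - a₂) + (c₃ - c₂)]`) and the inputs of Lemma 7.3, there is `ℓ`
with `(2 + δ)Y' ≤ ℓ Y` and `ℓ · x x_c W ≤ X' x_c W + x X_C' W + δ x x_c W'` (i.e.
`d/dt log Ψ ≤ ℓ ≤ d/dt log Φ`). [cite: Hamilton1986, §7, Lemmas 7.2–7.3, (7.4) (pp. 171–172)] -/
theorem pcoThree_ell {x xc MA MC tA tC k μ Y Y' X' XC' Nw Nz W TA TB TC G H δ : ℝ}
    (hx : 0 < x) (hxc : 0 < xc) (hW : 0 < W) (hY : 0 < Y) (hδ : 0 < δ) (hδ1 : δ ≤ 1)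
    (hδH : 8 * H * δ ≤ 1) (hδGH : 4 * G * H * δ ^ 2 ≤ 1)
    (hxa : x ≤ tA - x - MA) (haM : tA - x - MA ≤ MA) (hMA : MA ≤ H * x)
    (hxca : xc ≤ tC - xc - MC) (hcM : tC - xc - MC ≤ MC) (hMC : MC ≤ H * xc)
    (hk : 0 ≤ k) (hkμ : k ≤ μ) (hY2A : Y ^ 2 ≤ G * H * x ^ 2) (hY2C : Y ^ 2 ≤ G * H * xc ^ 2)
    (hNw : k ^ 2 ≤ Nw) (hNz : k ^ 2 ≤ Nz)
    (hX' : x ^ 2 + Nw + 2 * (MA * (tA - x - MA)) ≤ X')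
    (hXC' : xc ^ 2 + Nz + 2 * (MC * (tC - xc - MC)) ≤ XC')
    (hW' : (x + 2 * k + xc) * W ≤ TA + TC - 2 * TB)
    (hup : Y' ≤ (MA + MC + 2 * k) * Y - μ * ((2 * MA - (tA - x)) + (2 * MC - (tC - xc))))
    (hxM : x ≤ MA) (hxcM : xc ≤ MC) :
    ∃ ℓ : ℝ, (2 + δ) * Y' ≤ ℓ * Y ∧
      ℓ * (x * xc * W) ≤ X' * xc * W + x * XC' * W + δ * (x * xc * (TA - 2 * TB + TC)) := by
  have hμ0 : 0 ≤ μ := hk.trans hkμ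
  have h73A := lemma73 hx hxa haM hMA hk hkμ hY hY2A hδ hδ1 hδH hδGH
  have h73C := lemma73 hxc hxca hcM hMC hk hkμ hY hY2C hδ hδ1 hδH hδGH
  have h5 := pcoThree_logCompare hx hxc hδ hxM hxcM haM hcM (div_nonneg hμ0 hY.le) h73A h73C
  refine ⟨(x ^ 2 + k ^ 2 + 2 * MA * (tA - x - MA)) / x + (xc ^ 2 + k ^ 2 + 2 * MC * (tC - xc - MC)) / xc +
    δ * (x + 2 * k + xc), ?_, ?_⟩
  · -- `(2 + δ) Y' ≤ ℓ_up · Y ≤ ℓ · Y`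
    have t : μ / Y * Y = μ := div_mul_cancel₀ μ hY.ne'
    have e : (2 + δ) * ((MA + MC + 2 * k) * Y - μ * ((2 * MA - (tA - x)) + (2 * MC - (tC - xc)))) =
        ((2 + δ) * (MA + MC + 2 * k) - (2 + δ) * (μ / Y) * ((MA - (tA - x - MA)) + (MC - (tC - xc - MC)))) * Y := by
      rw [sub_mul, show (2 + δ) * (μ / Y) * ((MA - (tA - x - MA)) + (MC - (tC - xc - MC))) * Y =
        (2 + δ) * ((MA - (tA - x - MA)) + (MC - (tC - xc - MC))) * (μ / Y * Y) by ring, t]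
      ring
    have a1 := mul_le_mul_of_nonneg_left hup (show (0 : ℝ) ≤ 2 + δ by linarith)
    rw [e] at a1
    have a2 := mul_le_mul_of_nonneg_right h5 hY.le
    linarith
  · -- `ℓ · x x_c W ≤ Φ'/Φ · x x_c W`
    have t1 : (x ^ 2 + k ^ 2 + 2 * MA * (tA - x - MA)) / x * (x * xc * W) =
        (x ^ 2 + k ^ 2 + 2 * MA * (tA - x - MA)) * (xc * W) := by
      rw [show x * xc * W = x * (xc * W) by ring, ← mul_assoc, div_mul_cancel₀ _ hx.ne']
    have t2 : (xc ^ 2 + k ^ 2 + 2 * MC * (tC - xc - MC)) / xc * (x * xc * W) =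
        (xc ^ 2 + k ^ 2 + 2 * MC * (tC - xc - MC)) * (x * W) := by
      rw [show x * xc * W = xc * (x * W) by ring, ← mul_assoc, div_mul_cancel₀ _ hxc.ne']
    have e : ((x ^ 2 + k ^ 2 + 2 * MA * (tA - x - MA)) / x + (xc ^ 2 + k ^ 2 + 2 * MC * (tC - xc - MC)) / xc +
        δ * (x + 2 * k + xc)) * (x * xc * W) =
        (x ^ 2 + k ^ 2 + 2 * MA * (tA - x - MA)) * (xc * W) + (xc ^ 2 + k ^ 2 + 2 * MC * (tC - xc - MC)) * (x * W) +
          δ * (x * xc) * ((x + 2 * k + xc) * W) := by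
      rw [add_mul, add_mul, t1, t2]
      ring
    rw [e]
    have hxcW : 0 ≤ xc * W := by positivity
    have hxW : 0 ≤ x * W := by positivity
    have hδxxc : 0 ≤ δ * (x * xc) := by positivity
    have a1 := mul_le_mul_of_nonneg_right hX' hxcW
    have a2 := mul_le_mul_of_nonneg_right hXC' hxW
    have a3 := mul_le_mul_of_nonneg_left hW' hδxxc
    have a4 := mul_le_mul_of_nonneg_right hNw hxcW
    have a5 := mul_le_mul_of_nonneg_right hNz hxW
    linarith [a1, a2, a3, a4, a5]

/-! ### The sign condition at a minimiser -/

/-- **Decoupling at a minimiser of `𝒢` with `𝒢 ≤ 0`**: `Y ≠ 0`, `T` maximises `tr (BT)`, `w` and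
`z` minimise the Rayleigh quotients, and the frames maximise `Y²`. [folklore] -/
theorem pcoThree_decouple {J δ : ℝ} (hJ : 0 < J) (hδ : 0 < δ) {A B C : Matrix (Fin 3) (Fin 3) ℝ}
    {F : PP} {w z : Fin 3 → ℝ} {T : Fin 3 → Fin 3 → ℝ}
    (hF : F ∈ (pairSet ×ˢ pairSet : Set PP)) (hw : w ∈ unitSet) (hz : z ∈ unitSet)
    (hT : (Matrix.of T)ᵀ * Matrix.of T = 1)
    (hXpos : 0 < w ⬝ᵥ (A *ᵥ w)) (hXCpos : 0 < z ⬝ᵥ (C *ᵥ z))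
    (hWpos : ∀ T' : Matrix (Fin 3) (Fin 3) ℝ, T'ᵀ * T' = 1 → 0 < traceW (A, B, C) T')
    (hrmin : IsMinOn (pcoThreeG J δ (A, B, C)) pcoThreeSet ((F, (w, z)), T))
    (hG0 : pcoThreeG J δ (A, B, C) ((F, (w, z)), T) ≤ 0) :
    0 < kyFanQ B F ^ 2 ∧
      (∀ T' : Matrix (Fin 3) (Fin 3) ℝ, T'ᵀ * T' = 1 → (B * T').trace ≤ (B * Matrix.of T).trace) ∧
      (∀ r ∈ unitSet, w ⬝ᵥ (A *ᵥ w) ≤ r ⬝ᵥ (A *ᵥ r)) ∧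
      (∀ r ∈ unitSet, z ⬝ᵥ (C *ᵥ z) ≤ r ⬝ᵥ (C *ᵥ r)) ∧
      (∀ F' ∈ (pairSet ×ˢ pairSet : Set PP), kyFanQ B F' ^ 2 ≤ kyFanQ B F ^ 2) := by
  have hW : 0 < traceW (A, B, C) (Matrix.of T) := hWpos _ hT
  have hWd : 0 < traceW (A, B, C) (Matrix.of T) ^ δ := Real.rpow_pos_of_pos hW δ
  have hp1 : 0 < 1 + δ / 2 := by linarith
  have hG0' : J * (w ⬝ᵥ (A *ᵥ w)) * (z ⬝ᵥ (C *ᵥ z)) * traceW (A, B, C) (Matrix.of T) ^ δ -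
      (kyFanQ B F ^ 2) ^ (1 + δ / 2) ≤ 0 := hG0
  have hΦpos : 0 < J * (w ⬝ᵥ (A *ᵥ w)) * (z ⬝ᵥ (C *ᵥ z)) * traceW (A, B, C) (Matrix.of T) ^ δ := by
    positivity
  refine ⟨?_, ?_, ?_, ?_, ?_⟩
  · rcases (sq_nonneg (kyFanQ B F)).eq_or_lt with h | h
    · rw [← h, Real.zero_rpow hp1.ne'] at hG0'
      linarith
    · exact h
  · intro T' hT'
    have hT'' : Matrix.of.symm T' ∈ {T : Fin 3 → Fin 3 → ℝ | (Matrix.of T)ᵀ * Matrix.of T = 1} := by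
      simpa using hT'
    have h := hrmin (show ((F, (w, z)), Matrix.of.symm T') ∈ pcoThreeSet from ⟨⟨hF, hw, hz⟩, hT''⟩)
    simp only [mem_setOf_eq, pcoThreeG, Equiv.apply_symm_apply] at h
    have h1 : traceW (A, B, C) (Matrix.of T) ^ δ ≤ traceW (A, B, C) T' ^ δ := by
      by_contra hcon
      rw [not_le] at hcon
      have := mul_lt_mul_of_pos_left hcon (show 0 < J * (w ⬝ᵥ (A *ᵥ w)) * (z ⬝ᵥ (C *ᵥ z)) by positivity)
      linarith
    have h2 := (Real.rpow_le_rpow_iff hW.le (hWpos T' hT').le hδ).1 h1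
    simp only [traceW] at h2
    linarith
  · intro r hr
    have h := hrmin (show ((F, (r, z)), T) ∈ pcoThreeSet from ⟨⟨hF, hr, hz⟩, hT⟩)
    simp only [mem_setOf_eq, pcoThreeG] at h
    have h0 : 0 < J * (z ⬝ᵥ (C *ᵥ z)) * traceW (A, B, C) (Matrix.of T) ^ δ := by positivity
    by_contra hcon
    rw [not_le] at hcon
    have := mul_lt_mul_of_pos_left hcon h0
    linarith
  · intro r hr
    have h := hrmin (show ((F, (w, r)), T) ∈ pcoThreeSet from ⟨⟨hF, hw, hr⟩, hT⟩)
    simp only [mem_setOf_eq, pcoThreeG] at h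
    have h0 : 0 < J * (w ⬝ᵥ (A *ᵥ w)) * traceW (A, B, C) (Matrix.of T) ^ δ := by positivity
    by_contra hcon
    rw [not_le] at hcon
    have := mul_lt_mul_of_pos_left hcon h0
    linarith
  · intro F' hF'
    have h := hrmin (show ((F', (w, z)), T) ∈ pcoThreeSet from ⟨⟨hF', hw, hz⟩, hT⟩)
    simp only [mem_setOf_eq, pcoThreeG] at h
    have h1 : (kyFanQ B F' ^ 2) ^ (1 + δ / 2) ≤ (kyFanQ B F ^ 2) ^ (1 + δ / 2) := by linarith
    exact (Real.rpow_le_rpow_iff (sq_nonneg _) (sq_nonneg _) hp1).1 h1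

/-- **The logarithmic derivative bounds at the extremal configuration** (Hamilton 1986, p. 172):
with `(A, B, C) ∈ Z₂(m, G, H)`, `T` a maximiser of `tr (BT)`, `w`, `z` minimisers of the
Rayleigh quotients and a diagonal Ky Fan maximiser `(u₁, u₂), (v₁, v₂)` with `Y₀ > 0`, the
scalar bounds of `pcoThree_ell` hold for `x = wᵀAw`, `X' = wᵀA'w`, `Y = Y₀`, `Y' = Y₀'`,
`W = W(T)`, `W' = tr A' - 2 tr (B'T) + tr C'`. [cite: Hamilton1986, §7, Lemmas 7.2–7.3, (7.4) (pp. 171–172)] -/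
theorem pcoThree_logBounds {m G H δ : ℝ} (hm : 0 < m) (hG : 0 < G) (hδ : 0 < δ) (hδ1 : δ ≤ 1)
    (hδH : 8 * H * δ ≤ 1) (hδGH : 4 * G * H * δ ^ 2 ≤ 1)
    {A B C T : Matrix (Fin 3) (Fin 3) ℝ} (hA : A.IsSymm) (hC : C.IsSymm) (htr : A.trace = C.trace)
    (hop : OperatorGE (A, B, C) m) (hone : SingularValuesSumSqLEMinProd (A, B, C) G)
    (h2A : A.LargestLESmallestAdd H 0) (h2C : C.LargestLESmallestAdd H 0) (hT : Tᵀ * T = 1)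
    (hmaxT : ∀ T' : Matrix (Fin 3) (Fin 3) ℝ, T'ᵀ * T' = 1 → (B * T').trace ≤ (B * T).trace)
    {w z : Fin 3 → ℝ} (hw : w ⬝ᵥ w = 1) (hz : z ⬝ᵥ z = 1)
    (hminW : ∀ r ∈ unitSet, w ⬝ᵥ (A *ᵥ w) ≤ r ⬝ᵥ (A *ᵥ r))
    (hminZ : ∀ r ∈ unitSet, z ⬝ᵥ (C *ᵥ z) ≤ r ⬝ᵥ (C *ᵥ r))
    {u₁ u₂ v₁ v₂ : Fin 3 → ℝ} (hu₁ : u₁ ⬝ᵥ u₁ = 1) (hu₂ : u₂ ⬝ᵥ u₂ = 1) (hu : u₁ ⬝ᵥ u₂ = 0)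
    (hv₁ : v₁ ⬝ᵥ v₁ = 1) (hv₂ : v₂ ⬝ᵥ v₂ = 1) (hv : v₁ ⬝ᵥ v₂ = 0)
    (hmax₀ : ∀ u₁' u₂' v₁' v₂' : Fin 3 → ℝ, u₁' ⬝ᵥ u₁' = 1 → u₂' ⬝ᵥ u₂' = 1 → u₁' ⬝ᵥ u₂' = 0 →
      v₁' ⬝ᵥ v₁' = 1 → v₂' ⬝ᵥ v₂' = 1 → v₁' ⬝ᵥ v₂' = 0 →
      u₁' ⬝ᵥ (B *ᵥ v₁') + u₂' ⬝ᵥ (B *ᵥ v₂') ≤ u₁ ⬝ᵥ (B *ᵥ v₁) + u₂ ⬝ᵥ (B *ᵥ v₂))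
    (hdiag : u₁ ⬝ᵥ (B *ᵥ v₂) = 0) (hY0 : 0 < u₁ ⬝ᵥ (B *ᵥ v₁) + u₂ ⬝ᵥ (B *ᵥ v₂)) :
    ∃ ℓ : ℝ,
      (2 + δ) * (u₁ ⬝ᵥ ((A * B + B * C + (2 : ℝ) • B.sharp) *ᵥ v₁) +
          u₂ ⬝ᵥ ((A * B + B * C + (2 : ℝ) • B.sharp) *ᵥ v₂)) ≤ ℓ * (u₁ ⬝ᵥ (B *ᵥ v₁) + u₂ ⬝ᵥ (B *ᵥ v₂)) ∧
      ℓ * ((w ⬝ᵥ (A *ᵥ w)) * (z ⬝ᵥ (C *ᵥ z)) * traceW (A, B, C) T) ≤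
        (w ⬝ᵥ ((A * A + B * Bᵀ + (2 : ℝ) • A.sharp) *ᵥ w)) * (z ⬝ᵥ (C *ᵥ z)) * traceW (A, B, C) T +
          (w ⬝ᵥ (A *ᵥ w)) * (z ⬝ᵥ ((C * C + Bᵀ * B + (2 : ℝ) • C.sharp) *ᵥ z)) * traceW (A, B, C) T +
          δ * ((w ⬝ᵥ (A *ᵥ w)) * (z ⬝ᵥ (C *ᵥ z)) *
            ((field (A, B, C)).1.trace - 2 * ((field (A, B, C)).2.1 * T).trace + (field (A, B, C)).2.2.trace)) := by
  -- positivity of `x`, `x_c`, `W`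
  have hX : m ≤ w ⬝ᵥ (A *ᵥ w) := by have := hop.quad_fst w; rw [hw, mul_one] at this; exact this
  have hXC : m ≤ z ⬝ᵥ (C *ᵥ z) := by have := hop.quad_snd_snd z; rw [hz, mul_one] at this; exact this
  have hXpos : 0 < w ⬝ᵥ (A *ᵥ w) := by linarith
  have hXCpos : 0 < z ⬝ᵥ (C *ᵥ z) := by linarith
  have hW6 := traceW_ge_of_operatorGE hop hT
  have hW : 0 < traceW (A, B, C) T := by linarith
  -- maximisers of the Rayleigh quotients and the eigenvalue bounds
  obtain ⟨u₃, hu₃, hMA⟩ := exists_rayleigh_max A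
  obtain ⟨z₃, hz₃, hMC⟩ := exists_rayleigh_max C
  have hu₃1 : u₃ ⬝ᵥ u₃ = 1 := hu₃
  have hz₃1 : z₃ ⬝ᵥ z₃ = 1 := hz₃
  have hMA' : ∀ e : Fin 3 → ℝ, e ⬝ᵥ e = 1 → e ⬝ᵥ (A *ᵥ e) ≤ u₃ ⬝ᵥ (A *ᵥ u₃) := fun e he ↦ hMA e he
  have hMC' : ∀ e : Fin 3 → ℝ, e ⬝ᵥ e = 1 → e ⬝ᵥ (C *ᵥ e) ≤ z₃ ⬝ᵥ (C *ᵥ z₃) := fun e he ↦ hMC e he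
  obtain ⟨hxa, haM⟩ := trace_sub_min_sub_max_bounds (A := A) hw hu₃1 hminW hMA
  obtain ⟨hxca, hcM⟩ := trace_sub_min_sub_max_bounds (A := C) hz hz₃1 hminZ hMC
  have hxM : w ⬝ᵥ (A *ᵥ w) ≤ u₃ ⬝ᵥ (A *ᵥ u₃) := hMA w hw
  have hxcM : z ⬝ᵥ (C *ᵥ z) ≤ z₃ ⬝ᵥ (C *ᵥ z₃) := hMC z hz
  -- `k = |κ| = b₁`, `μ = min(μ₁, μ₂) = b₂`
  have hkw := normSq_transpose_ge_kappa_sq hu₁ hu₂ hu hv₁ hv₂ hv hmax₀ hdiag w hw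
  have hkz := normSq_ge_kappa_sq hu₁ hu₂ hu hv₁ hv₂ hv hmax₀ hdiag z hz
  have hkB : ∀ e : Fin 3 → ℝ, e ⬝ᵥ e = 1 →
      |(u₁ ⨯₃ u₂) ⬝ᵥ (B *ᵥ (v₁ ⨯₃ v₂))| ^ 2 ≤ (B *ᵥ e) ⬝ᵥ (B *ᵥ e) := fun e he ↦ by
    rw [sq_abs]; exact normSq_ge_kappa_sq hu₁ hu₂ hu hv₁ hv₂ hv hmax₀ hdiag e he
  have hkμ : |(u₁ ⨯₃ u₂) ⬝ᵥ (B *ᵥ (v₁ ⨯₃ v₂))| ≤ min (u₁ ⬝ᵥ (B *ᵥ v₁)) (u₂ ⬝ᵥ (B *ᵥ v₂)) :=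
    le_min (kyFanMax_kappa_le_fst hu₁ hu₂ hu hv₁ hv₂ hv hmax₀) (kyFanMax_kappa_le_snd hu₁ hu₂ hu hv₁ hv₂ hv hmax₀)
  -- the differential bounds (Lemmas 6.1, 6.2)
  have hup := kyFanMax_upper_gap (A := A) (C := C) hu₁ hu₂ hu hv₁ hv₂ hv hmax₀ hdiag hMA' hMC'
    (fun e e' he he' hee' ↦ pairSum_le_trace_sub_min hminW he he' hee')
    (fun e e' he he' hee' ↦ pairSum_le_trace_sub_min hminZ he he' hee')
  have hm2 : 0 < 2 * m := by positivity
  have hlowA := rayleighMin_field_ge (B := B) hA hm2 hop.twoSmallestEigenvaluesSumGE_fst hw hu₃1 hminW hMA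
  have hlowC := rayleighMin_field_ge (A := C) (B := Bᵀ) hC hm2 hop.twoSmallestEigenvaluesSumGE_snd_snd
    hz hz₃1 hminZ hMC
  rw [Matrix.transpose_transpose] at hlowC
  have hM0 : OperatorGE (A, B, C) 0 := fun v ↦ by
    have h1 := hop v
    have h2 := mul_nonneg hm.le (normSq_nonneg v)
    linarith
  have hW' := lemma62_lower hA hC htr hM0 hT hmaxT hminW hminZ hkB
  -- the algebraic inputs of Lemma 7.3
  have h2A' : u₃ ⬝ᵥ (A *ᵥ u₃) ≤ H * (w ⬝ᵥ (A *ᵥ w)) := by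
    have := h2A u₃ w hu₃1 hw; rwa [add_zero] at this
  have h2C' : z₃ ⬝ᵥ (C *ᵥ z₃) ≤ H * (z ⬝ᵥ (C *ᵥ z)) := by
    have := h2C z₃ z hz₃1 hz; rwa [add_zero] at this
  have hone' := hone u₁ u₂ v₁ v₂ w z hu₁ hu₂ hu hv₁ hv₂ hv hw hz
  obtain ⟨e₀, he₀, he₀le⟩ := exists_unit_rayleigh_le_trace_div_three C
  obtain ⟨f₀, hf₀, hf₀le⟩ := exists_unit_rayleigh_le_trace_div_three A
  have hXCle : z ⬝ᵥ (C *ᵥ z) ≤ H * (w ⬝ᵥ (A *ᵥ w)) := by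
    have h1 := hminZ e₀ he₀
    rw [← htr] at he₀le
    linarith
  have hXle : w ⬝ᵥ (A *ᵥ w) ≤ H * (z ⬝ᵥ (C *ᵥ z)) := by
    have h1 := hminW f₀ hf₀
    rw [htr] at hf₀le
    linarith
  have hY2A : (u₁ ⬝ᵥ (B *ᵥ v₁) + u₂ ⬝ᵥ (B *ᵥ v₂)) ^ 2 ≤ G * H * (w ⬝ᵥ (A *ᵥ w)) ^ 2 := by
    have t := mul_le_mul_of_nonneg_left hXCle (mul_nonneg hG.le hXpos.le)
    simp only at hone'
    linarith
  have hY2C : (u₁ ⬝ᵥ (B *ᵥ v₁) + u₂ ⬝ᵥ (B *ᵥ v₂)) ^ 2 ≤ G * H * (z ⬝ᵥ (C *ᵥ z)) ^ 2 := by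
    have t := mul_le_mul_of_nonneg_left hXle (mul_nonneg hG.le hXCpos.le)
    simp only at hone'
    linarith
  exact pcoThree_ell hXpos hXCpos hW hY0 hδ hδ1 hδH hδGH hxa haM h2A' hxca hcM h2C' (abs_nonneg _) hkμ
    hY2A hY2C (by rw [sq_abs]; exact hkw) (by rw [sq_abs]; exact hkz) hlowA hlowC hW' hup hxM hxcM

/-- **`Φ'/Φ ≤ 3R/m`** in multiplied form: with `X' ≤ R`, `X_C' ≤ R`, `W' ≤ 2R` (`R ≥ Σ|A'| + Σ|B'| + Σ|C'|`),
`x, x_c ≥ m`, `W ≥ 6m` and `0 ≤ δ ≤ 1`: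
`X' x_c W + x X_C' W + δ x x_c W' ≤ (3R/m) x x_c W`. [folklore] -/
theorem pcoThree_lPhi_le {m δ R : ℝ} (hm : 0 < m) (hδ : 0 ≤ δ) (hδ1 : δ ≤ 1) {p p' : Blocks}
    {w z : Fin 3 → ℝ} {T : Matrix (Fin 3) (Fin 3) ℝ} (hw : w ⬝ᵥ w = 1) (hz : z ⬝ᵥ z = 1) (hT : Tᵀ * T = 1)
    (hX : m ≤ w ⬝ᵥ (p.1 *ᵥ w)) (hXC : m ≤ z ⬝ᵥ (p.2.2 *ᵥ z)) (hW : 6 * m ≤ traceW p T)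
    (hR : (∑ k, ∑ l, |p'.1 k l|) + (∑ k, ∑ l, |p'.2.1 k l|) + ∑ k, ∑ l, |p'.2.2 k l| ≤ R) :
    (w ⬝ᵥ (p'.1 *ᵥ w)) * (z ⬝ᵥ (p.2.2 *ᵥ z)) * traceW p T +
        (w ⬝ᵥ (p.1 *ᵥ w)) * (z ⬝ᵥ (p'.2.2 *ᵥ z)) * traceW p T +
        δ * ((w ⬝ᵥ (p.1 *ᵥ w)) * (z ⬝ᵥ (p.2.2 *ᵥ z)) * traceW p' T) ≤
      3 * R / m * ((w ⬝ᵥ (p.1 *ᵥ w)) * (z ⬝ᵥ (p.2.2 *ᵥ z)) * traceW p T) := by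
  have hA'nn : 0 ≤ ∑ k, ∑ l, |p'.1 k l| := Finset.sum_nonneg fun k _ ↦ Finset.sum_nonneg fun l _ ↦ abs_nonneg _
  have hB'nn : 0 ≤ ∑ k, ∑ l, |p'.2.1 k l| := Finset.sum_nonneg fun k _ ↦ Finset.sum_nonneg fun l _ ↦ abs_nonneg _
  have hC'nn : 0 ≤ ∑ k, ∑ l, |p'.2.2 k l| := Finset.sum_nonneg fun k _ ↦ Finset.sum_nonneg fun l _ ↦ abs_nonneg _
  have hR0 : 0 ≤ R := by linarith
  have b1 : w ⬝ᵥ (p'.1 *ᵥ w) ≤ R := by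
    have h1 := (abs_le.1 (abs_quad_le_sum p'.1 hw)).2
    linarith
  have b2 : z ⬝ᵥ (p'.2.2 *ᵥ z) ≤ R := by
    have h1 := (abs_le.1 (abs_quad_le_sum p'.2.2 hz)).2
    linarith
  have b3 : traceW p' T ≤ 2 * R := by
    have h1 := (abs_le.1 (abs_trace_le_sum p'.1)).2
    have h2 := (abs_le.1 (abs_trace_mul_le_sum_of_orthogonal p'.2.1 hT)).1
    have h3 := (abs_le.1 (abs_trace_le_sum p'.2.2)).2
    simp only [traceW]
    linarith
  clear hR hA'nn hB'nn hC'nn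
  -- abstract the scalars
  generalize w ⬝ᵥ (p'.1 *ᵥ w) = X' at b1 ⊢
  generalize z ⬝ᵥ (p'.2.2 *ᵥ z) = XC' at b2 ⊢
  generalize traceW p' T = W' at b3 ⊢
  generalize w ⬝ᵥ (p.1 *ᵥ w) = x at hX ⊢
  generalize z ⬝ᵥ (p.2.2 *ᵥ z) = xc at hXC ⊢
  generalize traceW p T = W at hW ⊢
  have hx : 0 < x := by linarith
  have hxc : 0 < xc := by linarith
  have hWp : 0 < W := by linarith
  have e : 3 * R / m * (x * xc * W) = R / m * x * (xc * W) + R / m * xc * (x * W) + R / m * W * (x * xc) := by ring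
  rw [e]
  have hRm : 0 ≤ R / m := div_nonneg hR0 hm.le
  have t1 : X' ≤ R / m * x := by
    have : R ≤ R / m * x := by
      rw [div_mul_eq_mul_div, le_div_iff₀ hm]
      exact mul_le_mul_of_nonneg_left hX hR0
    linarith
  have t2 : XC' ≤ R / m * xc := by
    have : R ≤ R / m * xc := by
      rw [div_mul_eq_mul_div, le_div_iff₀ hm]
      exact mul_le_mul_of_nonneg_left hXC hR0
    linarith
  have t3 : δ * W' ≤ R / m * W := by
    have h6 : 6 * R ≤ R / m * W := by
      rw [div_mul_eq_mul_div, le_div_iff₀ hm]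
      nlinarith [mul_le_mul_of_nonneg_left hW hR0]
    rcases le_or_gt 0 W' with h | h
    · have : δ * W' ≤ 1 * W' := mul_le_mul_of_nonneg_right hδ1 h
      linarith
    · have : δ * W' ≤ 0 := mul_nonpos_of_nonneg_of_nonpos hδ h.le
      linarith
  have a1 := mul_le_mul_of_nonneg_right t1 (show 0 ≤ xc * W by positivity)
  have a2 := mul_le_mul_of_nonneg_right t2 (show 0 ≤ x * W by positivity)
  have a3 := mul_le_mul_of_nonneg_right t3 (show 0 ≤ x * xc by positivity)
  nlinarith [a1, a2, a3]

/-- **The sign condition at a minimiser of `𝒢`** (Hamilton 1986, p. 172): for `(A, B, C)` in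
`Z₂(m, G, H)` (`A, C` symmetric, `tr A = tr C`, `M ≥ m > 0`, (1), (2)), constants `0 < G, J`,
`0 < δ ≤ 1`, `8Hδ ≤ 1`, `4GHδ² ≤ 1`, and `R ≥ Σ|A'| + Σ|B'| + Σ|C'|` for the field, at a minimiser
`r` of `𝒢` over `pairSet² × unitSet² × O(3)` with `𝒢(r) ≤ 0`: `(3R/m) 𝒢(r) ≤ 𝒢'(r)`.
[cite: Hamilton1986, §7, Lemmas 7.2–7.3, (7.4), p. 172] -/
theorem pcoThree_sign {m G H J δ R : ℝ} (hm : 0 < m) (hG : 0 < G) (hJ : 0 < J) (hδ : 0 < δ)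
    (hδ1 : δ ≤ 1) (hδH : 8 * H * δ ≤ 1) (hδGH : 4 * G * H * δ ^ 2 ≤ 1) {p : Blocks}
    (hp : p ∈ pcoPinchingTwo m G H)
    (hR : (∑ k, ∑ l, |(field p).1 k l|) + (∑ k, ∑ l, |(field p).2.1 k l|) +
      ∑ k, ∑ l, |(field p).2.2 k l| ≤ R)
    {r : RR} (hr : r ∈ pcoThreeSet) (hrmin : IsMinOn (pcoThreeG J δ p) pcoThreeSet r)
    (hG0 : pcoThreeG J δ p r ≤ 0) :
    3 * R / m * pcoThreeG J δ p r ≤ pcoThreeG' J δ p (field p) r := by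
  obtain ⟨⟨F, w, z⟩, T⟩ := r
  obtain ⟨⟨hF, hw, hz⟩, hT⟩ := hr
  obtain ⟨A, B, C⟩ := p
  obtain ⟨⟨hA, hC⟩, htr, hop, hone, h2A, h2C⟩ := hp
  simp only at hA hC htr h2A h2C hF hw hz hT
  have hT' : (Matrix.of T)ᵀ * Matrix.of T = 1 := hT
  have hw1 : w ⬝ᵥ w = 1 := hw
  have hz1 : z ⬝ᵥ z = 1 := hz
  -- positivity of `x`, `x_c`, `W`
  have hX : m ≤ w ⬝ᵥ (A *ᵥ w) := by have := hop.quad_fst w; rw [hw1, mul_one] at this; exact this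
  have hXC : m ≤ z ⬝ᵥ (C *ᵥ z) := by have := hop.quad_snd_snd z; rw [hz1, mul_one] at this; exact this
  have hXpos : 0 < w ⬝ᵥ (A *ᵥ w) := by linarith
  have hXCpos : 0 < z ⬝ᵥ (C *ᵥ z) := by linarith
  have hWpos : ∀ T' : Matrix (Fin 3) (Fin 3) ℝ, T'ᵀ * T' = 1 → 0 < traceW (A, B, C) T' :=
    fun T' hT' ↦ by linarith [traceW_ge_of_operatorGE hop hT']
  have hW6 : 6 * m ≤ traceW (A, B, C) (Matrix.of T) := traceW_ge_of_operatorGE hop hT'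
  have hW : 0 < traceW (A, B, C) (Matrix.of T) := hWpos _ hT'
  -- decoupling
  obtain ⟨hY2pos, hmaxT, hminW, hminZ, hmaxF⟩ :=
    pcoThree_decouple hJ hδ hF hw hz hT' hXpos hXCpos hWpos hrmin hG0
  -- flip to a non-negative maximiser, then rotate to a diagonal one
  obtain ⟨Fb, hFb, hYnn, hflip⟩ : ∃ Fb ∈ (pairSet ×ˢ pairSet : Set PP), 0 ≤ kyFanQ B Fb ∧
      ∃ σ : ℝ, σ ^ 2 = 1 ∧ ∀ X : Matrix (Fin 3) (Fin 3) ℝ, kyFanQ X Fb = σ * kyFanQ X F := by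
    rcases le_or_gt 0 (kyFanQ B F) with h | h
    · exact ⟨F, hF, h, 1, by norm_num, fun X ↦ by ring⟩
    · exact ⟨_, flip_mem hF, by rw [kyFanQ_flip]; linarith, -1, by norm_num, fun X ↦ by rw [kyFanQ_flip]; ring⟩
  obtain ⟨σ, hσ, hσX⟩ := hflip
  have hmaxb : ∀ F' ∈ (pairSet ×ˢ pairSet : Set PP), kyFanQ B F' ≤ kyFanQ B Fb := by
    intro F' hF'
    have h1 := hmaxF F' hF'
    have h2 : kyFanQ B Fb ^ 2 = kyFanQ B F ^ 2 := by rw [hσX B, mul_pow, hσ, one_mul]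
    rw [← h2] at h1
    nlinarith [abs_le_abs (le_abs_self (kyFanQ B F')) (neg_le_abs _), sq_abs (kyFanQ B F'),
      abs_nonneg (kyFanQ B F')]
  obtain ⟨F₀, hF₀, hF₀X, hdiag⟩ := exists_diag_maximiser hFb hmaxb
  obtain ⟨⟨u₁, u₂⟩, ⟨v₁, v₂⟩⟩ := F₀
  obtain ⟨⟨hu₁, hu₂, hu⟩, ⟨hv₁, hv₂, hv⟩⟩ := hF₀
  simp only at hdiag hF₀X hu₁ hu₂ hu hv₁ hv₂ hv
  have hmax₀ : ∀ u₁' u₂' v₁' v₂' : Fin 3 → ℝ, u₁' ⬝ᵥ u₁' = 1 → u₂' ⬝ᵥ u₂' = 1 → u₁' ⬝ᵥ u₂' = 0 →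
      v₁' ⬝ᵥ v₁' = 1 → v₂' ⬝ᵥ v₂' = 1 → v₁' ⬝ᵥ v₂' = 0 →
      u₁' ⬝ᵥ (B *ᵥ v₁') + u₂' ⬝ᵥ (B *ᵥ v₂') ≤ u₁ ⬝ᵥ (B *ᵥ v₁) + u₂ ⬝ᵥ (B *ᵥ v₂) := by
    intro u₁' u₂' v₁' v₂' a b c d e f
    have h := hmaxb ((u₁', u₂'), (v₁', v₂')) ⟨⟨a, b, c⟩, ⟨d, e, f⟩⟩
    rw [← hF₀X B] at h
    exact h
  -- `Y₀ = |Y| > 0`, `Y₀ Y₀' = Y Y'`, `Y₀² = Y²`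
  have hY0 : 0 ≤ u₁ ⬝ᵥ (B *ᵥ v₁) + u₂ ⬝ᵥ (B *ᵥ v₂) := by
    have h1 : u₁ ⬝ᵥ (B *ᵥ v₁) + u₂ ⬝ᵥ (B *ᵥ v₂) = kyFanQ B Fb := hF₀X B
    rw [h1]; exact hYnn
  have hYY : ∀ X : Matrix (Fin 3) (Fin 3) ℝ,
      (u₁ ⬝ᵥ (B *ᵥ v₁) + u₂ ⬝ᵥ (B *ᵥ v₂)) * (u₁ ⬝ᵥ (X *ᵥ v₁) + u₂ ⬝ᵥ (X *ᵥ v₂)) =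
        kyFanQ B F * kyFanQ X F := by
    intro X
    have h1 : u₁ ⬝ᵥ (B *ᵥ v₁) + u₂ ⬝ᵥ (B *ᵥ v₂) = σ * kyFanQ B F := (hF₀X B).trans (hσX B)
    have h2 : u₁ ⬝ᵥ (X *ᵥ v₁) + u₂ ⬝ᵥ (X *ᵥ v₂) = σ * kyFanQ X F := (hF₀X X).trans (hσX X)
    rw [h1, h2]
    linear_combination (kyFanQ B F * kyFanQ X F) * hσ
  have hY2 : (u₁ ⬝ᵥ (B *ᵥ v₁) + u₂ ⬝ᵥ (B *ᵥ v₂)) ^ 2 = kyFanQ B F ^ 2 := by rw [sq, hYY B, sq]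
  have hY0pos : 0 < u₁ ⬝ᵥ (B *ᵥ v₁) + u₂ ⬝ᵥ (B *ᵥ v₂) := by
    rcases hY0.eq_or_lt with h | h
    · rw [← h] at hY2; nlinarith
    · exact h
  -- the logarithmic bounds and `Φ'/Φ ≤ 3R/m`
  obtain ⟨ℓ, hℓ1, hℓ2⟩ := pcoThree_logBounds hm hG hδ hδ1 hδH hδGH hA hC htr hop hone h2A h2C hT'
    hmaxT hw1 hz1 hminW hminZ hu₁ hu₂ hu hv₁ hv₂ hv hmax₀ hdiag hY0pos
  have hC3 := pcoThree_lPhi_le (p := (A, B, C)) (p' := field (A, B, C)) hm hδ.le hδ1 hw1 hz1 hT' hX hXC hW6 hR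
  have hYY' := hYY (field (A, B, C)).2.1
  clear hR hrmin hmaxF hmaxb hmax₀ hF₀X hσX hminW hminZ hmaxT hWpos hone h2A h2C
  -- unfold `𝒢`, `𝒢'` at `r` and pass to scalars
  simp only [pcoThreeG, pcoThreeG'] at hG0 ⊢
  simp only [field, traceW] at hℓ1 hℓ2 hC3 hYY' hW hW6 hG0 ⊢
  -- rewrite powers: `W^δ = W^(δ-1) W`, `(Y²)^{1+δ/2} = (Y²)^{δ/2} Y²`
  rw [← hY2] at hY2pos hG0 ⊢
  generalize hWE : A.trace - 2 * (B * Matrix.of T).trace + C.trace = W at hℓ2 hC3 hW hW6 hG0 ⊢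
  generalize hY0E : u₁ ⬝ᵥ (B *ᵥ v₁) + u₂ ⬝ᵥ (B *ᵥ v₂) = Y₀ at hℓ1 hY0pos hYY' hY2pos hG0 ⊢
  have hWd1 : 0 < W ^ (δ - 1) := Real.rpow_pos_of_pos hW _
  have hWdW : W ^ δ = W ^ (δ - 1) * W := by
    rw [Real.rpow_sub_one hW.ne', div_mul_cancel₀ _ hW.ne']
  have hSp1 : 0 < (Y₀ ^ 2) ^ (δ / 2) := Real.rpow_pos_of_pos hY2pos _
  have hSp : (Y₀ ^ 2) ^ (1 + δ / 2) = (Y₀ ^ 2) ^ (δ / 2) * Y₀ ^ 2 := by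
    rw [add_comm, Real.rpow_add hY2pos, Real.rpow_one]
  rw [hWdW, hSp] at hG0 ⊢
  generalize W ^ (δ - 1) = Wd1 at hWd1 hG0 ⊢
  generalize (Y₀ ^ 2) ^ (δ / 2) = Sp1 at hSp1 hG0 ⊢
  -- scalar endgame
  generalize w ⬝ᵥ (A *ᵥ w) = x at hX hXpos hℓ2 hC3 hG0 ⊢
  generalize z ⬝ᵥ (C *ᵥ z) = xc at hXC hXCpos hℓ2 hC3 hG0 ⊢
  generalize w ⬝ᵥ ((A * A + B * Bᵀ + (2 : ℝ) • A.sharp) *ᵥ w) = X' at hℓ2 hC3 ⊢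
  generalize z ⬝ᵥ ((C * C + Bᵀ * B + (2 : ℝ) • C.sharp) *ᵥ z) = XC' at hℓ2 hC3 ⊢
  generalize (A * A + B * Bᵀ + (2 : ℝ) • A.sharp).trace - 2 * ((A * B + B * C + (2 : ℝ) • B.sharp) * Matrix.of T).trace +
    (C * C + Bᵀ * B + (2 : ℝ) • C.sharp).trace = W' at hℓ2 hC3 ⊢
  generalize u₁ ⬝ᵥ ((A * B + B * C + (2 : ℝ) • B.sharp) *ᵥ v₁) + u₂ ⬝ᵥ ((A * B + B * C + (2 : ℝ) • B.sharp) *ᵥ v₂) = Y₀'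
    at hℓ1 hYY' ⊢
  generalize kyFanQ B F = Y at hYY' ⊢
  generalize kyFanQ (A * B + B * C + (2 : ℝ) • B.sharp) F = Y' at hYY' ⊢
  have hpos3 : 0 < x * xc * W := by positivity
  have hℓ3 : ℓ ≤ 3 * R / m := le_of_mul_le_mul_right (hℓ2.trans hC3) hpos3
  have hle : J * x * xc * (Wd1 * W) - Sp1 * Y₀ ^ 2 ≤ 0 := hG0
  have p1 := mul_le_mul_of_nonneg_left hℓ2 (show 0 ≤ J * Wd1 by positivity)
  have p2 := mul_le_mul_of_nonneg_left hℓ1 (show 0 ≤ Sp1 * Y₀ by positivity)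
  have p4 := mul_nonneg_of_nonpos_of_nonpos hle (sub_nonpos.2 hℓ3)
  have eY : 2 * Y * Y' = 2 * (Y₀ * Y₀') := by rw [hYY']; ring
  rw [eY]
  linarith [p1, p2, p4]

/-! ### Thm. 7.1 (3), ODE part -/

/-- **Hamilton 1986, Thm. 7.1, inequality (3), ODE part (proved)**: for `0 < m, G, J`,
`0 < δ ≤ 1`, `8Hδ ≤ 1`, `4GHδ² ≤ 1`, the set `{(b₂ + b₃)^{2+δ} ≤ J a₁c₁(a - 2b + c)^δ}` is
forward invariant under Hamilton's ODE `M' = M² + M#` relative to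
`Z₂(m, G, H) = {A, C symmetric} ∩ {tr A = tr C} ∩ {M ≥ m} ∩ {(1)} ∩ {(2)}` ("the inequality
`(b₂ + b₃)^{2+δ} ≤ J a₁c₁(a - 2b + c)^δ` will be preserved for any constant `J`", p. 172).
[cite: Hamilton1986, §7, Thm. 7.1 (3) (pp. 170–172)] -/
theorem hamilton1986_pinchingThree_ode {m G H J δ : ℝ} (hm : 0 < m) (hG : 0 < G) (hJ : 0 < J)
    (hδ : 0 < δ) (hδ1 : δ ≤ 1) (hδH : 8 * H * δ ≤ 1) (hδGH : 4 * G * H * δ ^ 2 ≤ 1) :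
    IsInvariantRel field (fun _ ↦ pcoPinchingTwo m G H) (fun _ ↦ {p | SingularValuesSumPowLE p J δ}) := by
  intro γ t₀ t₁ _ h₁ hγ hK hin
  have hγc := IsSolutionOn.continuousOn hγ
  -- `W > 0` along the constrained solution
  have hWpos : ∀ z ∈ Icc t₀ t₁ ×ˢ pcoThreeSet, traceW (γ z.1) (Matrix.of z.2.2) ≠ 0 := by
    rintro ⟨s, r⟩ ⟨hs, hr⟩
    have h := traceW_ge_of_operatorGE (hK s hs).2.2.1 hr.2
    exact (ne_of_gt (by simp only at h ⊢; linarith))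
  have hGc := continuousOn_pcoThreeG_family J δ hδ.le hγc pcoThreeSet
  have hG'c := continuousOn_pcoThreeG'_family J δ hδ.le hγc pcoThreeSet hWpos
  have hGd : ∀ r ∈ pcoThreeSet, ∀ s ∈ Icc t₀ t₁, _root_.HasDerivAt (fun t ↦ pcoThreeG J δ (γ t) r)
      (pcoThreeG' J δ (γ s) (field (γ s)) r) s :=
    fun r hr s hs ↦ hasDerivAt_pcoThreeG J hδ (hγ s hs) r (hWpos (s, r) ⟨hs, hr⟩)
  -- uniform bound `R` for `Σ|A'| + Σ|B'| + Σ|C'|`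
  have hent : ∀ {f : Blocks → Matrix (Fin 3) (Fin 3) ℝ}, Continuous f →
      ContinuousOn (fun t ↦ ∑ k, ∑ l, |f (field (γ t)) k l|) (Icc t₀ t₁) := by
    intro f hf
    have h : ContinuousOn (fun t ↦ f (field (γ t))) (Icc t₀ t₁) :=
      (hf.comp continuous_field).comp_continuousOn hγc
    exact continuousOn_finsetSum _ fun k _ ↦ continuousOn_finsetSum _ fun l _ ↦
      ((continuousOn_pi.1 (continuousOn_pi.1 h k) l)).abs
  have hScont : ContinuousOn (fun t ↦ (∑ k, ∑ l, |(field (γ t)).1 k l|) +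
      (∑ k, ∑ l, |(field (γ t)).2.1 k l|) + ∑ k, ∑ l, |(field (γ t)).2.2 k l|) (Icc t₀ t₁) :=
    ((hent (f := fun p ↦ p.1) continuous_fst).add
      (hent (f := fun p ↦ p.2.1) (continuous_fst.comp continuous_snd))).add
      (hent (f := fun p ↦ p.2.2) (continuous_snd.comp continuous_snd))
  obtain ⟨sR, -, hR⟩ := isCompact_Icc.exists_isMaxOn (nonempty_Icc.2 h₁) hScont
  set R := (∑ k, ∑ l, |(field (γ sR)).1 k l|) + (∑ k, ∑ l, |(field (γ sR)).2.1 k l|) +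
    ∑ k, ∑ l, |(field (γ sR)).2.2 k l| with hRdef
  have hR' : ∀ s ∈ Icc t₀ t₁, (∑ k, ∑ l, |(field (γ s)).1 k l|) + (∑ k, ∑ l, |(field (γ s)).2.1 k l|) +
      ∑ k, ∑ l, |(field (γ s)).2.2 k l| ≤ R := fun s hs ↦ hR hs
  have hR0 : 0 ≤ R := le_trans (add_nonneg (add_nonneg
    (Finset.sum_nonneg fun k _ ↦ Finset.sum_nonneg fun l _ ↦ abs_nonneg _)
    (Finset.sum_nonneg fun k _ ↦ Finset.sum_nonneg fun l _ ↦ abs_nonneg _))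
    (Finset.sum_nonneg fun k _ ↦ Finset.sum_nonneg fun l _ ↦ abs_nonneg _)) (hR' t₀ (left_mem_Icc.2 h₁))
  have hC0 : 0 ≤ 3 * R / m := by positivity
  have key := minOverSet_nonneg_of_deriv (G := fun t r ↦ pcoThreeG J δ (γ t) r)
    (G' := fun t r ↦ pcoThreeG' J δ (γ t) (field (γ t)) r) isCompact_pcoThreeSet pcoThreeSet_nonempty
    hGc hGd hG'c h₁ one_pos hC0 (η := 1) (fun s hs r hr hrmin _ hG0 ↦ ?_) ?_
  · rw [mem_setOf_eq, singularValuesSumPowLE_iff]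
    exact (le_minOverSet_iff isCompact_pcoThreeSet pcoThreeSet_nonempty (continuousOn_slice
      (G := fun t r ↦ pcoThreeG J δ (γ t) r) hGc (right_mem_Icc.2 h₁)) 0).1 key
  · have hsI : s ∈ Icc t₀ t₁ := Ico_subset_Icc_self hs
    exact pcoThree_sign hm hG hJ hδ hδ1 hδH hδGH (hK s hsI) (hR' s hsI) hr hrmin hG0
  · refine (le_minOverSet_iff isCompact_pcoThreeSet pcoThreeSet_nonempty (continuousOn_slice
      (G := fun t r ↦ pcoThreeG J δ (γ t) r) hGc (left_mem_Icc.2 h₁)) 0).2 ?_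
    exact (singularValuesSumPowLE_iff J δ (γ t₀)).1 hin

/-! ### The first three groups together -/

/-- **The set cut out by the first three groups of inequalities of Thm. 7.1** on `{M ≥ m}`:
`Z₃ = Z₂(m, G, H) ∩ {(b₂ + b₃)^{2+δ} ≤ J a₁c₁(a - 2b + c)^δ}`. [cite: Hamilton1986, §7, Thm. 7.1 (1)–(3) (p. 170)] -/
def pcoPinchingThree (m G H J δ : ℝ) : Set Blocks :=
  pcoPinchingTwo m G H ∩ {p | SingularValuesSumPowLE p J δ}

/-- **`Z₃` is forward invariant under Hamilton's ODE** (constants as in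
`hamilton1986_pinchingThree_ode` and `isInvariant_pcoPinchingTwo`). [cite: Hamilton1986, §7, Thm. 7.1 (pp. 170–172)] -/
theorem isInvariant_pcoPinchingThree {m G H J δ : ℝ} (hm : 0 < m) (hG : 0 < G) (hH : G + 1 ≤ H)
    (hJ : 0 < J) (hδ : 0 < δ) (hδ1 : δ ≤ 1) (hδH : 8 * H * δ ≤ 1) (hδGH : 4 * G * H * δ ^ 2 ≤ 1) :
    IsInvariant field (fun _ ↦ pcoPinchingThree m G H J δ) :=
  (isInvariant_pcoPinchingTwo hm hG hH).inter_rel_self (hamilton1986_pinchingThree_ode hm hG hJ hδ hδ1 hδH hδGH)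

/-- The set (3) is closed (for `δ ≥ 0`: both sides are continuous in `(A, B, C)`). [folklore] -/
theorem isClosed_singularValuesSumPowLE (J : ℝ) {δ : ℝ} (hδ : 0 ≤ δ) :
    IsClosed {p : Blocks | SingularValuesSumPowLE p J δ} := by
  have e : {p : Blocks | SingularValuesSumPowLE p J δ} = ⋂ r ∈ pcoThreeSet, {p | 0 ≤ pcoThreeG J δ p r} := by
    ext p; simp only [mem_setOf_eq, singularValuesSumPowLE_iff, mem_iInter]
  rw [e]
  exact isClosed_biInter fun r _ ↦ isClosed_le continuous_const
    ((continuous_pcoThreeG J δ hδ).comp (continuous_id.prodMk continuous_const))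

/-- `Z₃` is closed. [cite: Hamilton1986, §7, Thm. 7.1 (p. 170, "Clearly `Z` is closed")] -/
theorem isClosed_pcoPinchingThree (m G H J : ℝ) {δ : ℝ} (hδ : 0 ≤ δ) :
    IsClosed (pcoPinchingThree m G H J δ) :=
  (isClosed_pcoPinchingTwo m G H).inter (isClosed_singularValuesSumPowLE J hδ)

/-- `tr ((-N) T) = - tr (N T)` lets the reflection act on `T ↦ -T ∈ O(3)`: the set (3) is
symmetric under `B ↦ -B`. [folklore] -/
theorem SingularValuesSumPowLE.reflectB {p : Blocks} {J δ : ℝ} (h : SingularValuesSumPowLE p J δ) :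
    SingularValuesSumPowLE (reflectB p) J δ := by
  intro u₁ u₂ v₁ v₂ w z T hu₁ hu₂ hu hv₁ hv₂ hv hw hz hT
  have hT' : (-T)ᵀ * (-T) = 1 := by simpa using hT
  have := h u₁ u₂ v₁ v₂ w z (-T) hu₁ hu₂ hu hv₁ hv₂ hv hw hz hT'
  simp only [HamiltonODE.reflectB, Matrix.neg_mulVec, dotProduct_neg]
  simp only [Matrix.mul_neg, Matrix.trace_neg] at this
  simp only [Matrix.neg_mul, Matrix.trace_neg]
  convert this using 2
  ring

/-- `Z₃` is symmetric under `B ↦ -B`. [folklore] -/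
theorem reflectB_mem_pcoPinchingThree {m G H J δ : ℝ} {p : Blocks} (h : p ∈ pcoPinchingThree m G H J δ) :
    reflectB p ∈ pcoPinchingThree m G H J δ :=
  ⟨reflectB_mem_pcoPinchingTwo h.1, SingularValuesSumPowLE.reflectB h.2⟩

/-! ### Convexity of (3) on `{M ≥ m}` (Hamilton 1986, p. 170: "That `Z` is convex follows from Lemma 6.3") -/

/-- **The chord inequality behind the convexity of (3)**: for weights `a, b ≥ 0` (by
homogeneity `a + b = 1` is not needed), `J ≥ 0`, `δ > 0` and `Xᵢ, Zᵢ, Wᵢ ≥ 0`, the conditions `(Yᵢ²)^{1+δ/2} ≤ J Xᵢ Zᵢ Wᵢ^δ` pass to the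
convex combination — because `|Y| ≤ (J X Z W^δ)^{1/(2+δ)}` and the right-hand side, a weighted
geometric mean `J^{1/p} (√(XZ))^{2/p} W^{δ/p}` (`p = 2 + δ`), is concave (Lemma 6.3 twice:
`geomMean_combo_le_sqrt`, `combo_rpow_mul_rpow_le`). [cite: Hamilton1986, §6, Lemma 6.3 (p. 170); §7, Thm. 7.1 (p. 170)] -/
theorem rpow_pow_combo_le {a b J δ Y₁ Y₂ X₁ X₂ Z₁ Z₂ W₁ W₂ : ℝ} (ha : 0 ≤ a) (hb : 0 ≤ b)
    (hJ : 0 ≤ J) (hδ : 0 < δ) (hX₁ : 0 ≤ X₁) (hX₂ : 0 ≤ X₂) (hZ₁ : 0 ≤ Z₁)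
    (hZ₂ : 0 ≤ Z₂) (hW₁ : 0 ≤ W₁) (hW₂ : 0 ≤ W₂)
    (h₁ : (Y₁ ^ 2) ^ (1 + δ / 2) ≤ J * X₁ * Z₁ * W₁ ^ δ)
    (h₂ : (Y₂ ^ 2) ^ (1 + δ / 2) ≤ J * X₂ * Z₂ * W₂ ^ δ) :
    ((a * Y₁ + b * Y₂) ^ 2) ^ (1 + δ / 2) ≤
      J * (a * X₁ + b * X₂) * (a * Z₁ + b * Z₂) * (a * W₁ + b * W₂) ^ δ := by
  set p := 2 + δ with hp
  have hp0 : 0 < p := by linarith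
  have hpinv : 0 < p⁻¹ := inv_pos.2 hp0
  -- `(Y²)^{1+δ/2} = |Y|^p`
  have key : ∀ Y : ℝ, (Y ^ 2) ^ (1 + δ / 2) = |Y| ^ p := by
    intro Y
    rw [← sq_abs, ← Real.rpow_two, ← Real.rpow_mul (abs_nonneg Y)]
    congr 1
    rw [hp]; ring
  -- `g = (J X Z W^δ)^{1/p} = J^{1/p} (√(XZ))^{2/p} W^{δ/p}`
  have hg : ∀ {X Z W : ℝ}, 0 ≤ X → 0 ≤ Z → 0 ≤ W →
      (J * X * Z * W ^ δ) ^ p⁻¹ = J ^ p⁻¹ * ((X * Z).sqrt ^ (2 / p) * W ^ (δ / p)) := by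
    intro X Z W hX hZ hW
    have hXZ : 0 ≤ X * Z := mul_nonneg hX hZ
    rw [mul_assoc J, Real.mul_rpow (by positivity) (Real.rpow_nonneg hW δ),
      Real.mul_rpow hJ hXZ, ← Real.rpow_mul hW, mul_assoc]
    congr 2
    conv_lhs => rw [← Real.sq_sqrt hXZ, ← Real.rpow_two, ← Real.rpow_mul (Real.sqrt_nonneg _)]
    congr 1
  -- `|Yᵢ| ≤ gᵢ`
  have hle : ∀ {Y X Z W : ℝ}, 0 ≤ X → 0 ≤ Z → 0 ≤ W → (Y ^ 2) ^ (1 + δ / 2) ≤ J * X * Z * W ^ δ →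
      |Y| ≤ (J * X * Z * W ^ δ) ^ p⁻¹ := by
    intro Y X Z W hX hZ hW h
    rw [key] at h
    have h1 := Real.rpow_le_rpow (Real.rpow_nonneg (abs_nonneg Y) p) h hpinv.le
    rwa [Real.rpow_rpow_inv (abs_nonneg Y) hp0.ne'] at h1
  have a1 := hle hX₁ hZ₁ hW₁ h₁
  have a2 := hle hX₂ hZ₂ hW₂ h₂
  rw [hg hX₁ hZ₁ hW₁] at a1
  rw [hg hX₂ hZ₂ hW₂] at a2
  -- concavity of the geometric mean (Lemma 6.3 twice)
  have h2p : 0 < 2 / p := by positivity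
  have hδp : 0 < δ / p := by positivity
  have hsum : 2 / p + δ / p = 1 := by rw [← add_div, hp, div_self hp0.ne']
  have c1 := combo_rpow_mul_rpow_le (Real.sqrt_nonneg (X₁ * Z₁)) (Real.sqrt_nonneg (X₂ * Z₂)) hW₁ hW₂
    ha hb h2p hδp hsum
  have c2 : (a * (X₁ * Z₁).sqrt + b * (X₂ * Z₂).sqrt) ^ (2 / p) ≤
      ((a * X₁ + b * X₂) * (a * Z₁ + b * Z₂)).sqrt ^ (2 / p) :=
    Real.rpow_le_rpow (by positivity) (geomMean_combo_le_sqrt ha hb hX₁ hX₂ hZ₁ hZ₂) h2p.le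
  have c3 : (a * (X₁ * Z₁).sqrt + b * (X₂ * Z₂).sqrt) ^ (2 / p) * (a * W₁ + b * W₂) ^ (δ / p) ≤
      ((a * X₁ + b * X₂) * (a * Z₁ + b * Z₂)).sqrt ^ (2 / p) * (a * W₁ + b * W₂) ^ (δ / p) :=
    mul_le_mul_of_nonneg_right c2 (Real.rpow_nonneg (by positivity) _)
  -- chain
  have hXc : 0 ≤ a * X₁ + b * X₂ := by positivity
  have hZc : 0 ≤ a * Z₁ + b * Z₂ := by positivity
  have hWc : 0 ≤ a * W₁ + b * W₂ := by positivity
  have hJp : 0 ≤ J ^ p⁻¹ := Real.rpow_nonneg hJ _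
  have habs : |a * Y₁ + b * Y₂| ≤ (J * (a * X₁ + b * X₂) * (a * Z₁ + b * Z₂) * (a * W₁ + b * W₂) ^ δ) ^ p⁻¹ := by
    rw [hg hXc hZc hWc]
    calc |a * Y₁ + b * Y₂| ≤ |a * Y₁| + |b * Y₂| := abs_add_le _ _
      _ = a * |Y₁| + b * |Y₂| := by rw [abs_mul, abs_mul, abs_of_nonneg ha, abs_of_nonneg hb]
      _ ≤ a * (J ^ p⁻¹ * ((X₁ * Z₁).sqrt ^ (2 / p) * W₁ ^ (δ / p))) +
          b * (J ^ p⁻¹ * ((X₂ * Z₂).sqrt ^ (2 / p) * W₂ ^ (δ / p))) := by gcongr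
      _ = J ^ p⁻¹ * (a * ((X₁ * Z₁).sqrt ^ (2 / p) * W₁ ^ (δ / p)) +
          b * ((X₂ * Z₂).sqrt ^ (2 / p) * W₂ ^ (δ / p))) := by ring
      _ ≤ J ^ p⁻¹ * (((a * X₁ + b * X₂) * (a * Z₁ + b * Z₂)).sqrt ^ (2 / p) * (a * W₁ + b * W₂) ^ (δ / p)) :=
          mul_le_mul_of_nonneg_left (c1.trans c3) hJp
  have hGc : 0 ≤ J * (a * X₁ + b * X₂) * (a * Z₁ + b * Z₂) * (a * W₁ + b * W₂) ^ δ := by positivity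
  have hfin := Real.rpow_le_rpow (abs_nonneg _) habs hp0.le
  rw [Real.rpow_inv_rpow hGc hp0.ne'] at hfin
  rw [key]
  exact hfin

/-- **(3) is convex on `{M ≥ m}`, `m ≥ 0`, `J ≥ 0`, `δ > 0`**, chord form (weights `a, b ≥ 0`). [cite: Hamilton1986, §7, Thm. 7.1 (p. 170); §6, Lemma 6.3 (p. 170)] -/
theorem SingularValuesSumPowLE.combo {x y : Blocks} {m J δ a b : ℝ} (hm : 0 ≤ m) (hJ : 0 ≤ J) (hδ : 0 < δ)
    (hxo : OperatorGE x m) (hyo : OperatorGE y m)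
    (hx : SingularValuesSumPowLE x J δ) (hy : SingularValuesSumPowLE y J δ) (ha : 0 ≤ a) (hb : 0 ≤ b) :
    SingularValuesSumPowLE (a • x + b • y) J δ := by
  intro u₁ u₂ v₁ v₂ w z T hu₁ hu₂ hu hv₁ hv₂ hv hw hz hT
  simp only [combo_fst, combo_snd_fst, combo_snd_snd]
  rw [two_quad_combo, quad_combo, quad_combo]
  have eW : (a • x.1 + b • y.1).trace - 2 * ((a • x.2.1 + b • y.2.1) * T).trace + (a • x.2.2 + b • y.2.2).trace =
      a * (x.1.trace - 2 * (x.2.1 * T).trace + x.2.2.trace) +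
        b * (y.1.trace - 2 * (y.2.1 * T).trace + y.2.2.trace) := by
    simp only [Matrix.trace_add, Matrix.trace_smul, Matrix.add_mul, Matrix.smul_mul, smul_eq_mul]
    ring
  rw [eW]
  have hX₁ : 0 ≤ w ⬝ᵥ (x.1 *ᵥ w) := by have := hxo.quad_fst w; rw [hw, mul_one] at this; linarith
  have hX₂ : 0 ≤ w ⬝ᵥ (y.1 *ᵥ w) := by have := hyo.quad_fst w; rw [hw, mul_one] at this; linarith
  have hZ₁ : 0 ≤ z ⬝ᵥ (x.2.2 *ᵥ z) := by have := hxo.quad_snd_snd z; rw [hz, mul_one] at this; linarith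
  have hZ₂ : 0 ≤ z ⬝ᵥ (y.2.2 *ᵥ z) := by have := hyo.quad_snd_snd z; rw [hz, mul_one] at this; linarith
  have hW₁ : 0 ≤ x.1.trace - 2 * (x.2.1 * T).trace + x.2.2.trace := by
    have := traceW_ge_of_operatorGE hxo hT; simp only [traceW] at this; linarith
  have hW₂ : 0 ≤ y.1.trace - 2 * (y.2.1 * T).trace + y.2.2.trace := by
    have := traceW_ge_of_operatorGE hyo hT; simp only [traceW] at this; linarith
  exact rpow_pow_combo_le ha hb hJ hδ hX₁ hX₂ hZ₁ hZ₂ hW₁ hW₂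
    (hx u₁ u₂ v₁ v₂ w z T hu₁ hu₂ hu hv₁ hv₂ hv hw hz hT) (hy u₁ u₂ v₁ v₂ w z T hu₁ hu₂ hu hv₁ hv₂ hv hw hz hT)

/-- **`Z₃` is convex** for `m ≥ 0`, `G ≥ 0`, `J ≥ 0`, `δ > 0` ("That `Z` is convex follows from
Lemma 6.3", p. 170). [cite: Hamilton1986, §7, Thm. 7.1 (p. 170)] -/
theorem convex_pcoPinchingThree {m G J δ : ℝ} (hm : 0 ≤ m) (hG : 0 ≤ G) (hJ : 0 ≤ J) (hδ : 0 < δ)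
    (H : ℝ) : Convex ℝ (pcoPinchingThree m G H J δ) := by
  rintro x ⟨hx2, hx3⟩ y ⟨hy2, hy3⟩ a b ha hb hab
  exact ⟨convex_pcoPinchingTwo hm hG H hx2 hy2 ha hb hab,
    SingularValuesSumPowLE.combo hm hJ hδ hx2.2.2.1 hy2.2.2.1 hx3 hy3 ha hb⟩


end HamiltonODE

end Literature.Geometry.Riemannian

end
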